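import Summits.Ventures.PercRepro.Matrix
import Summits.Ventures.PercRepro.Reach

/-!
# PercRepro — the 64 adjacency matrices on `Fin 4` and the shape of the kernel-checked census (typer-2, gen 4)

Interface of the (d) generator (typer-1 (g5) owns the kernel facts): an upper triangle is
`b : Fin 6 → Bool` (positions `upperPos4`, index table `upperIdx`), `matrixOf4 b` the symmetric
matrix it spans. `graphOf` only reads the upper triangle (`matrixOf4_upperOf4`,
`cubeSumC011_graphOf_eq_upper`), so

* **`LemmaBPlusSimpleInjUpTo_of_upper`** — the 64 facts
  `∀ m injective, 0 ≤ (graphOf (matrixOf4 b)).cubeSumC011Z m` (`b` ranging over `Fin 6 → Bool`)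
  give `LemmaBPlusSimpleInjUpTo 4`, hence **`C005UpTo_of_upper`**, **`C011UpTo_of_upper`**.
-/

namespace PercRepro

/-- The six upper-triangle positions of a `4 × 4` matrix. -/
def upperPos4 : Fin 6 → Fin 4 × Fin 4 := ![(0, 1), (0, 2), (0, 3), (1, 2), (1, 3), (2, 3)]

/-- The upper-triangle index of a position (symmetric; the diagonal is unused). -/
def upperIdx : Fin 4 → Fin 4 → Fin 6 :=
  ![![0, 0, 1, 2], ![0, 0, 3, 4], ![1, 3, 0, 5], ![2, 4, 5, 0]]

/-- The symmetric matrix with the upper triangle `b` and zero diagonal. -/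
def matrixOf4 (b : Fin 6 → Bool) (i j : Fin 4) : Bool := if i = j then false else b (upperIdx i j)

/-- The upper triangle of a matrix. -/
def upperOf4 (A : Fin 4 → Fin 4 → Bool) : Fin 6 → Bool :=
  fun k => A (upperPos4 k).1 (upperPos4 k).2

/-- The index table inverts the position table on the upper triangle. -/
theorem upperPos4_upperIdx : ∀ i j : Fin 4, i < j → upperPos4 (upperIdx i j) = (i, j) := by
  decide

/-- `matrixOf4 (upperOf4 A)` agrees with `A` on the upper triangle. -/
theorem matrixOf4_upperOf4 (A : Fin 4 → Fin 4 → Bool) (i j : Fin 4) (hij : i < j) :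
    A i j = matrixOf4 (upperOf4 A) i j := by
  unfold matrixOf4 upperOf4
  rw [if_neg (ne_of_lt hij), upperPos4_upperIdx i j hij]

/-- The class sum of `graphOf A` is that of the graph of its upper triangle. -/
theorem cubeSumC011_graphOf_eq_upper (A : Fin 4 → Fin 4 → Bool) (m : Fin 4 → Fin 4) :
    (MultiGraph.graphOf A).cubeSumC011 m =
      (MultiGraph.graphOf (matrixOf4 (upperOf4 A))).cubeSumC011 m :=
  (MultiGraph.cubeSumC011_graphOf_congr (fun i j hij => matrixOf4_upperOf4 A i j hij) m).symm

/-- **The 64-triangle census gives `LemmaBPlusSimpleInjUpTo 4`**: the hypothesis is the conjunction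
of the 64 kernel facts (one per upper triangle `b`). -/
theorem LemmaBPlusSimpleInjUpTo_of_upper
    (h : ∀ (b : Fin 6 → Bool) (m : Fin 4 → Fin 4), Function.Injective m →
      0 ≤ (MultiGraph.graphOf (matrixOf4 b)).cubeSumC011Z m) :
    LemmaBPlusSimpleInjUpTo 4 := by
  refine LemmaBPlusSimpleInjUpTo_of_graphOf 4 fun A m hm => ?_
  rw [cubeSumC011_graphOf_eq_upper, MultiGraph.cubeSumC011_nonneg_iff_Z]
  exact h _ m hm

/-- **C-005 on ≤ 4 vertices from the 64 kernel facts.** -/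
theorem C005UpTo_of_upper
    (h : ∀ (b : Fin 6 → Bool) (m : Fin 4 → Fin 4), Function.Injective m →
      0 ≤ (MultiGraph.graphOf (matrixOf4 b)).cubeSumC011Z m) : C005UpTo 4 :=
  C005UpTo_of_simpleInj (LemmaBPlusSimpleInjUpTo_of_upper h)

/-- **C-011 on ≤ 4 vertices from the 64 kernel facts.** -/
theorem C011UpTo_of_upper
    (h : ∀ (b : Fin 6 → Bool) (m : Fin 4 → Fin 4), Function.Injective m →
      0 ≤ (MultiGraph.graphOf (matrixOf4 b)).cubeSumC011Z m) : C011UpTo 4 :=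
  C011UpTo_of_simpleInj (LemmaBPlusSimpleInjUpTo_of_upper h)

end PercRepro
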